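import Literature.Probability.Percolation.SelfRefinementMeasure
import Literature.Probability.Percolation.KohlerSchindlerTassionRSW
import Summits.CriticalPhenomena.CardyFormulaZ2.Theorems.CardySelfRefinementCriticalPathRSWStubCone3LocalA
import Summits.CriticalPhenomena.CardyFormulaZ2.Theorems.CardySelfRefinementCriticalPathRSWStubCone3GraphB
import Summits.CriticalPhenomena.CardyFormulaZ2.Theorems.CardySelfRefinementCriticalPathRSWStubCone3Events

/-!
# Stub `stub_cone3` of line `finite-size-envelope` (crux `CriticalPathRSW`), part 6:
local combinatorics of a tuple, II — the chain lemma and the one-sided (chain) case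

Support file for item `stmt-CriticalPhenomena-10267` (stub `stub_cone3`).  Same setting and local
notations as part I (box `B = [-M, M] × [-N, N]`, sides `L`, `R`, tuple `(b, d)` in the frame
`pt⟪α, β⟫`, sub-edges `T`, interior labels `F`).  The crossing predicate is now written at the level
of configurations, `edgeConfig V ∈ KST2023.crossing M N`, and "`v` is joined to the side `L'`" as
`edgeConfig V ∈ openCrossing B L' {v}` (bridges `Cone3.edgeConfig_mem_crossing_iff`,
`Cone3.edgeConfig_mem_openCrossing_singleton_iff`).  Proved here:

* the abstract **chain lemma** (`Cone3.exists_flip_of_chain`): a property holding for `∅` and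
  failing for a finite set `F` flips somewhere along `S ↦ S ∪ {f}`;
* the two-sided case at the level of configurations (`Cone3.twoSided_of_crossing`,
  `Cone3.crossing_of_twoSided`, `Cone3.not_crossing_of_twoSided`);
* **the chain case** (`Cone3.chain_case`): if the tuple is closed, the sides are not joined, opening
  the whole tuple joins them, and the configuration with `T ∪ F` closed is NOT two-sided, then for
  some `S₁ ⊆ F` and `f ∈ F \ S₁`, after closing `S₁` and opening the tuple the interior label `f`
  is pivotal.

References: Grimmett 1999 §2.4 (pivotality); Aizenman–Grimmett 1991 §3 (local modifications).
-/

noncomputable section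

namespace Summit.CriticalPhenomena.CardyFormulaZ2.Cruxes.CriticalPathRSW.FiniteSizeEnvelope

open Set
open Literature.Probability.LatticeModels Literature.Probability.Percolation

namespace Cone3

variable {M N : ℕ} {b : Site 2} {d d' : Fin 2}

set_option quotPrecheck false

/-- The local frame of the tuple `(b, d)`: `pt⟪α, β⟫ = 3b + α e_d + β e_{d'}`. -/
local notation "pt⟪" α ", " β "⟫" =>
  ((3 : ℤ) • b + (α : ℤ) • (Pi.single d (1 : ℤ) : Site 2) + (β : ℤ) • (Pi.single d' (1 : ℤ) : Site 2))

/-- Neighbours of `a` through an open label of `U`, inside `B`. -/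
local notation "nbr⟪" B ", " U ", " a "⟫" =>
  {b : Site 2 | a ∈ B ∧ b ∈ B ∧ ∃ d : Fin 2,
    (b = a + Pi.single d 1 ∧ (a, d) ∈ U) ∨ (a = b + Pi.single d 1 ∧ (b, d) ∈ U)}

/-- The open cluster of `a` inside `B`. -/
local notation "clus⟪" B ", " U ", " a "⟫" =>
  {b : Site 2 | Relation.ReflTransGen (fun x y : Site 2 => y ∈ nbr⟪B, U, x⟫) a b}

/-- The vertices joined inside `B` to the side `L`. -/
local notation "side⟪" B ", " U ", " L "⟫" => {v : Site 2 | ∃ a ∈ L, v ∈ clus⟪B, U, a⟫}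

/-- The label configurations joining `L` to `R` inside `B`. -/
local notation "joined⟪" B ", " L ", " R "⟫" =>
  {U : Set (Site 2 × Fin 2) | ∃ a ∈ L, ∃ b ∈ R, b ∈ clus⟪B, U, a⟫}

/-- The box. -/
local notation "Bx" => (KST2023.box M N)

/-- Its left side. -/
local notation "Lx" => {x : Site 2 | x ∈ KST2023.box M N ∧ x 0 = -(M : ℤ)}

/-- Its right side. -/
local notation "Rx" => {x : Site 2 | x ∈ KST2023.box M N ∧ x 0 = (M : ℤ)}

/-- Crossing of the box by a label configuration. -/
local notation "Cr⟪" V "⟫" => (edgeConfig V ∈ KST2023.crossing M N)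

/-- The three sub-edges of the tuple. -/
local notation "Tl" =>
  ({(pt⟪0, 0⟫, d), (pt⟪1, 0⟫, d), (pt⟪2, 0⟫, d)} : Set (Site 2 × Fin 2))

/-- The four interior labels at the interior vertices of the tuple. -/
local notation "Fl" =>
  ({(pt⟪1, 0⟫, d'), (pt⟪1, -1⟫, d'), (pt⟪2, 0⟫, d'), (pt⟪2, -1⟫, d')} : Set (Site 2 × Fin 2))

/-- The same four labels, as a `Finset`. -/
local notation "Flf" =>
  ({(pt⟪1, 0⟫, d'), (pt⟪1, -1⟫, d'), (pt⟪2, 0⟫, d'), (pt⟪2, -1⟫, d')} : Finset (Site 2 × Fin 2))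

/-- The two-sided condition for a label configuration `V`: `u ↔ L, w ↔ R` or `w ↔ L, u ↔ R`. -/
local notation "TwoSided⟪" V "⟫" =>
  ((edgeConfig V ∈ openCrossing Bx Lx {pt⟪0, 0⟫} ∧ edgeConfig V ∈ openCrossing Bx Rx {pt⟪3, 0⟫}) ∨
    (edgeConfig V ∈ openCrossing Bx Lx {pt⟪3, 0⟫} ∧ edgeConfig V ∈ openCrossing Bx Rx {pt⟪0, 0⟫}))

/-! ### The chain lemma -/

/-- **Chain lemma.** If a property of finite subsets holds for `∅` and fails for `F`, then it
flips at some step `S ↦ insert f S` with `S ⊆ F`, `f ∈ F \ S`. -/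
theorem exists_flip_of_chain {α : Type*} [DecidableEq α] (g : Finset α → Prop) :
    ∀ F : Finset α, g ∅ → ¬ g F → ∃ S, S ⊆ F ∧ ∃ f ∈ F, f ∉ S ∧ g S ∧ ¬ g (insert f S) := by
  classical
  intro F
  induction F using Finset.induction_on with
  | empty => exact fun h0 h1 => absurd h0 h1
  | insert a F ha ih =>
    intro h0 h1
    by_cases h : g F
    · exact ⟨F, Finset.subset_insert a F, a, Finset.mem_insert_self a F, ha, h, h1⟩
    · obtain ⟨S, hS, f, hf, hfS, hgS, hgf⟩ := ih h0 h
      exact ⟨S, hS.trans (Finset.subset_insert a F), f, Finset.mem_insert_of_mem hf, hfS, hgS, hgf⟩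

/-! ### Frame helpers -/

/-- Coordinate mixing: the box is a product. -/
theorem pt_mem_box_mix (hd : d' ≠ d) {α β α' β' : ℤ} (h1 : pt⟪α, β⟫ ∈ Bx) (h2 : pt⟪α', β'⟫ ∈ Bx) :
    pt⟪α, β'⟫ ∈ Bx := by
  rcases fin2_cases hd with ⟨h0, -⟩ | ⟨h0, -⟩
  · rw [pt_mem_box_iff_of_eq_zero hd h0] at h1 h2 ⊢
    exact ⟨h1.1, h2.2⟩
  · rw [pt_mem_box_iff_of_eq_one hd h0] at h1 h2 ⊢
    exact ⟨h2.1, h1.2⟩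

/-- The sides of the box lie in the box (left). -/
theorem left_subset : Lx ⊆ Bx := fun _ hx => hx.1

/-- The sides of the box lie in the box (right). -/
theorem right_subset : Rx ⊆ Bx := fun _ hx => hx.1

/-! ### The two-sided case at the level of configurations -/

/-- **From a crossing through the tuple to the two-sided case**, configuration form. -/
theorem twoSided_of_crossing (hd : d' ≠ d) {V : Set (Site 2 × Fin 2)} (hT : ∀ e ∈ Tl, e ∉ V)
    (hF : ∀ e ∈ Fl, e ∉ V) (hu : pt⟪0, 0⟫ ∈ Bx) (hw : pt⟪3, 0⟫ ∈ Bx)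
    (hm1 : pt⟪1, 0⟫ ∉ Lx ∧ pt⟪1, 0⟫ ∉ Rx) (hm2 : pt⟪2, 0⟫ ∉ Lx ∧ pt⟪2, 0⟫ ∉ Rx)
    (hno : ¬ Cr⟪V⟫) (hyes : Cr⟪V ∪ Tl⟫) : TwoSided⟪V⟫ := by
  rw [edgeConfig_mem_crossing_iff] at hno hyes
  rw [edgeConfig_mem_openCrossing_singleton_iff V left_subset hu,
    edgeConfig_mem_openCrossing_singleton_iff V right_subset hw,
    edgeConfig_mem_openCrossing_singleton_iff V left_subset hw,
    edgeConfig_mem_openCrossing_singleton_iff V right_subset hu]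
  exact two_sided_of_joined hd hT hF hm1 hm2 hno hyes

/-- **In the two-sided case the whole tuple joins the sides.** -/
theorem crossing_of_twoSided (hd : d' ≠ d) {V : Set (Site 2 × Fin 2)}
    (hbox : ∀ j : ℤ, 0 ≤ j → j ≤ 3 → pt⟪j, 0⟫ ∈ Bx) (htwo : TwoSided⟪V⟫) : Cr⟪V ∪ Tl⟫ := by
  have hu := hbox 0 le_rfl (by norm_num)
  have hw := hbox 3 (by norm_num) le_rfl
  rw [edgeConfig_mem_openCrossing_singleton_iff V left_subset hu,
    edgeConfig_mem_openCrossing_singleton_iff V right_subset hw,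
    edgeConfig_mem_openCrossing_singleton_iff V left_subset hw,
    edgeConfig_mem_openCrossing_singleton_iff V right_subset hu] at htwo
  rw [edgeConfig_mem_crossing_iff]
  -- the open path `u - m₁ - m₂ - w` through the sub-edges
  have h01 : pt⟪1, 0⟫ ∈ nbr⟪Bx, V ∪ Tl, pt⟪0, 0⟫⟫ := by
    have := nbr_single_d hd (U := V ∪ Tl) hu (by simpa using hbox 1 (by norm_num) (by norm_num))
      (Or.inr (by simp))
    simpa using this
  have h12 : pt⟪2, 0⟫ ∈ nbr⟪Bx, V ∪ Tl, pt⟪1, 0⟫⟫ := by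
    have := nbr_single_d hd (U := V ∪ Tl) (hbox 1 (by norm_num) (by norm_num))
      (by simpa using hbox 2 (by norm_num) (by norm_num)) (Or.inr (by simp))
    simpa using this
  have h23 : pt⟪3, 0⟫ ∈ nbr⟪Bx, V ∪ Tl, pt⟪2, 0⟫⟫ := by
    have := nbr_single_d hd (U := V ∪ Tl) (hbox 2 (by norm_num) (by norm_num))
      (by simpa using hw) (Or.inr (by simp))
    simpa using this
  have huw : pt⟪3, 0⟫ ∈ clus⟪Bx, V ∪ Tl, pt⟪0, 0⟫⟫ :=
    clus_step (clus_step (clus_step (mem_clus_self _) h01) h12) h23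
  rcases htwo with ⟨⟨l, hl, hlu⟩, ⟨r, hr, hrw⟩⟩ | ⟨⟨l, hl, hlw⟩, ⟨r, hr, hru⟩⟩
  · exact ⟨l, hl, r, hr, clus_trans (clus_trans (clus_mono Set.subset_union_left _ hlu) huw)
      (clus_symm (clus_mono Set.subset_union_left _ hrw))⟩
  · exact ⟨l, hl, r, hr, clus_trans (clus_trans (clus_mono Set.subset_union_left _ hlw) (clus_symm huw))
      (clus_symm (clus_mono Set.subset_union_left _ hru))⟩

/-- **In the two-sided case a proper subset of the tuple never joins the sides**, configuration form. -/
theorem not_crossing_of_twoSided (hd : d' ≠ d) {V : Set (Site 2 × Fin 2)} (hT : ∀ e ∈ Tl, e ∉ V)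
    (hF : ∀ e ∈ Fl, e ∉ V) (hu : pt⟪0, 0⟫ ∈ Bx) (hw : pt⟪3, 0⟫ ∈ Bx)
    (hm1 : pt⟪1, 0⟫ ∉ Lx ∧ pt⟪1, 0⟫ ∉ Rx) (hm2 : pt⟪2, 0⟫ ∉ Lx ∧ pt⟪2, 0⟫ ∉ Rx) (huR : pt⟪0, 0⟫ ∉ Rx)
    (hno : ¬ Cr⟪V⟫) (htwo : TwoSided⟪V⟫) {A : Set (Site 2 × Fin 2)} (hA : A ⊆ Tl)
    (hmiss : (pt⟪0, 0⟫, d) ∉ A ∨ (pt⟪1, 0⟫, d) ∉ A ∨ (pt⟪2, 0⟫, d) ∉ A) : ¬ Cr⟪V ∪ A⟫ := by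
  rw [edgeConfig_mem_openCrossing_singleton_iff V left_subset hu,
    edgeConfig_mem_openCrossing_singleton_iff V right_subset hw,
    edgeConfig_mem_openCrossing_singleton_iff V left_subset hw,
    edgeConfig_mem_openCrossing_singleton_iff V right_subset hu] at htwo
  rw [edgeConfig_mem_crossing_iff] at hno ⊢
  exact not_joined_of_two_sided hd hT hF hm1 hm2 huR hno htwo hA hmiss

/-! ### The chain case -/

/-- The `Finset` of interior labels has the set `F` as its coercion. -/
theorem coe_Flf : (↑Flf : Set (Site 2 × Fin 2)) = Fl := by
  simp only [Finset.coe_insert, Finset.coe_singleton]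

/-- **The chain case.** Suppose the tuple is closed in `W \ T`, the sides are not joined, opening the
whole tuple joins them, and the configuration with `T ∪ F` closed is not two-sided.  Then for some
`S₁ ⊆ F` and `f ∈ F \ S₁`: with `S₁ ∪ {f}` closed and `T` open the sides are joined iff `f` is
opened, i.e. `f` is pivotal. -/
theorem chain_case (hd : d' ≠ d) {W : Set (Site 2 × Fin 2)} (hu : pt⟪0, 0⟫ ∈ Bx) (hw : pt⟪3, 0⟫ ∈ Bx)
    (hm1 : pt⟪1, 0⟫ ∉ Lx ∧ pt⟪1, 0⟫ ∉ Rx) (hm2 : pt⟪2, 0⟫ ∉ Lx ∧ pt⟪2, 0⟫ ∉ Rx)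
    (hyes : Cr⟪(W \ Tl) ∪ Tl⟫) (hno : ¬ Cr⟪W \ Tl⟫) (hnot : ¬ TwoSided⟪W \ (Tl ∪ Fl)⟫) :
    ∃ S₁ ∈ (Flf).powerset, ∃ f ∈ Flf, f ∉ S₁ ∧
      Cr⟪(W \ (Tl ∪ ↑S₁ ∪ {f})) ∪ (Tl ∪ {f})⟫ ∧ ¬ Cr⟪(W \ (Tl ∪ ↑S₁ ∪ {f})) ∪ Tl⟫ := by
  classical
  have h0 : Cr⟪(W \ (Tl ∪ ↑(∅ : Finset (Site 2 × Fin 2)))) ∪ Tl⟫ := by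
    simpa only [Finset.coe_empty, Set.union_empty] using hyes
  have h1 : ¬ Cr⟪(W \ (Tl ∪ ↑Flf)) ∪ Tl⟫ := by
    intro h
    rw [coe_Flf] at h
    refine hnot (twoSided_of_crossing hd (V := W \ (Tl ∪ Fl)) ?_ ?_ hu hw hm1 hm2 ?_ h)
    · intro e he h'; exact h'.2 (Or.inl he)
    · intro e he h'; exact h'.2 (Or.inr he)
    · intro h'
      exact hno (crossing_mono (Set.sdiff_subset_sdiff_right Set.subset_union_left) h')
  obtain ⟨S, hS, f, hf, hfS, hgS, hgf⟩ :=
    exists_flip_of_chain (fun S : Finset (Site 2 × Fin 2) => Cr⟪(W \ (Tl ∪ ↑S)) ∪ Tl⟫) Flf h0 h1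
  refine ⟨S, Finset.mem_powerset.2 hS, f, hf, hfS, ?_, ?_⟩
  · refine crossing_mono (fun e he => ?_) hgS
    rcases he with ⟨heW, hno'⟩ | heT
    · by_cases hef : e ∈ ({f} : Set (Site 2 × Fin 2))
      · exact Or.inr (Or.inr hef)
      · exact Or.inl ⟨heW, fun h => h.elim hno' hef⟩
    · exact Or.inr (Or.inl heT)
  · intro h
    apply hgf
    refine crossing_mono (fun e he => ?_) h
    rcases he with ⟨heW, hnX⟩ | heT
    · refine Or.inl ⟨heW, fun h' => hnX ?_⟩
      rcases h' with h' | h'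
      · exact Or.inl (Or.inl h')
      · rw [Finset.coe_insert, Set.mem_insert_iff] at h'
        rcases h' with h' | h'
        · exact Or.inr (Set.mem_singleton_iff.2 h')
        · exact Or.inl (Or.inr h')
    · exact Or.inr heT

/-! ### Tuples whose sub-edges never matter -/

/-- Labels with both ends in the left side never matter for the crossing. -/
theorem cr_union_iff_of_left {V A : Set (Site 2 × Fin 2)}
    (hA : ∀ ℓ ∈ A, ℓ.1 ∈ Lx ∧ ℓ.1 + Pi.single ℓ.2 1 ∈ Lx) : Cr⟪V ∪ A⟫ ↔ Cr⟪V⟫ := by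
  rw [edgeConfig_mem_crossing_iff, edgeConfig_mem_crossing_iff]
  exact joined_union_iff_of_ends_mem hA

/-- Labels with both ends in the right side never matter for the crossing. -/
theorem cr_union_iff_of_right {V A : Set (Site 2 × Fin 2)}
    (hA : ∀ ℓ ∈ A, ℓ.1 ∈ Rx ∧ ℓ.1 + Pi.single ℓ.2 1 ∈ Rx) : Cr⟪V ∪ A⟫ ↔ Cr⟪V⟫ := by
  rw [edgeConfig_mem_crossing_iff, edgeConfig_mem_crossing_iff]
  constructor
  · exact fun h => joined_symm ((joined_union_iff_of_ends_mem hA).1 (joined_symm h))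
  · exact fun h => joined_symm ((joined_union_iff_of_ends_mem hA).2 (joined_symm h))

/-- Labels without both ends in the box never matter for the crossing. -/
theorem cr_union_iff_of_not_mem_box {V A : Set (Site 2 × Fin 2)}
    (hA : ∀ ℓ ∈ A, ¬ (ℓ.1 ∈ Bx ∧ ℓ.1 + Pi.single ℓ.2 1 ∈ Bx)) : Cr⟪V ∪ A⟫ ↔ Cr⟪V⟫ := by
  rw [edgeConfig_mem_crossing_iff, edgeConfig_mem_crossing_iff]
  refine joined_congr (fun ℓ hℓ => ?_)
  constructor
  · rintro (h | h)
    · exact h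
    · exact absurd hℓ (hA ℓ h)
  · exact fun h => Or.inl h

end Cone3

/-- **Registered sub-goal `stub_cone3_localB` of stub `stub_cone3`** (`Cone3.cr_union_iff_of_not_mem_box` with all local notations
expanded). -/
theorem stub_cone3_localB : ∀ {M N : ℕ} {V A : Set (Site 2 × Fin 2)} (hA : ∀ ℓ ∈ A, ¬ (ℓ.1 ∈ ((KST2023.box M N)) ∧ ℓ.1 + Pi.single ℓ.2 1 ∈ ((KST2023.box M N)))), ((edgeConfig (V ∪ A) ∈ KST2023.crossing M N)) ↔ ((edgeConfig (V) ∈ KST2023.crossing M N)) := by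
  intro M N V A hA
  exact Cone3.cr_union_iff_of_not_mem_box hA

end Summit.CriticalPhenomena.CardyFormulaZ2.Cruxes.CriticalPathRSW.FiniteSizeEnvelope

end
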